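import Literature.MathematicalPhysics.QuantumFieldTheory.Balaban1983to89.Beta.DyadicShell
import Literature.MathematicalPhysics.QuantumFieldTheory.Balaban1983to89.Beta.LeadingCoefficient
import HarnessLib

/-!
# Gawędzki–Kupiainen 1985, Appendix 1 (4), last two steps: the lattice bubble is `≥ O(1)·log L` — integer-lattice minorants

**Citation header (reproduction of PUBLISHED work; literature file of the Balaban lattice Yang–Mills cell
`pub-balaban`, β sub-cell seat LIT2, `HOME/BETA/TRANSFER.md` §4 (d) / §13; companion of
`GawedzkiKupiainen1985.LLargeDominance` v1.3, whose header lists the present estimate under "NOT reproduced: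
… the lattice bubble sum "(1/Λ_n)Σ_q |p−q|⁻²|q|⁻² ≥ O(1)|log p²|" of (4)").**
K. Gawędzki, A. Kupiainen, *Massless lattice φ⁴₄ theory: rigorous control of a renormalizable asymptotically
free model*, Commun. Math. Phys. **99** (1985) 197–252 [GawedzkiKupiainenMasslessLattice1985], Appendix 1
p. 247, display (4) (called (A1.4) in the cell's files), read on the rendered journal page
(`HOME/b2b-balaban-beta-lit2/g3/renders/gk99/gk1985-cmp99-p051-x2.png`).  The chain (4) ends
"≥ O(1)L⁴ (1/Λ_n²) Σ_{0≠p,q; |p_μ|<π/L; −π<q_μ≤π} (1/|p−q|²)(1/|q|²) ≥ O(1)L⁴ (1/Λ_n) Σ_{0≠p; |p_μ|<π/L} |log p²|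
≥ O(1) log L, (4)  where in the fifth step we have used the uniform bounds for the Fourier transforms Ĝ_n(p),
see Appendix of [16]. Equations (2)–(4) give immediately (1) ≥ O(1) log L. (5)", with p. 247 (3) "with O(1)
L independent"; the momenta run over the dual of the periodic box, "0 ≠ p, q ∈ 2πL^{−N+n}ℤ^d, −π < p_μ, q_μ ≤ π"
(second line of (4)), `d = 4`, and `Λ_n` denotes the number of sites.

**What is reproduced (everything PROVED; no definitions, no named facts — D-0026).**  The two final
inequalities of (4) — the SIXTH step (the one-loop lattice bubble at external momentum `p` is `≥ O(1)|log p²|`)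
and the SEVENTH (its average over the block-momentum window `|p_μ| < π/L`, weighted by `L⁴`, is `≥ O(1) log L`)
— as ELEMENTARY MINORANTS WITH EXPLICIT CONSTANTS, in integer coordinates: momenta `p = 2πk/T`, `q = 2πl/T`
with `k, l ∈ ℤ⁴`, `T` the side of the periodic box, representatives `|l_μ| ≤ R` (`T = 2R + 1`; for an even
side the symmetric box `|l_μ| ≤ R < T/2` is a sub-box, and every summand is `≥ 0`, so a minorant over the
sub-box is a minorant), `|·|` the Euclidean length of the representative (`Beta.LeadingCoefficient.normSq`,
`Beta.DyadicShell.toReal`), shells in the sup norm (`LatticeModels.annulus`, `Beta.DyadicShell.supNorm`):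
* `bubbleSum_lower` (step 6): for `k ≠ 0` and `2‖k‖_∞ ≤ R`,
  `(16/9)·log((R+1)/(2‖k‖_∞)) ≤ Σ_{l ≠ 0, k; ‖l‖_∞ ≤ R} 1/(|k−l|²|l|²)` — restrict to the sup-shells
  `2‖k‖_∞ ≤ ‖l‖_∞ = s ≤ R`, on which `|k−l|²|l|² ≤ 9s²·4s²` (`bubbleTerm_lower`), count `#{‖l‖_∞ = s} =
  64s³ + 16s ≥ 64s³` (`Beta.TransferUV.card_annulus_succ_four`), and sum the harmonic tail
  `Σ_{s=2‖k‖_∞}^{R} 1/s ≥ log((R+1)/(2‖k‖_∞))` (`log_div_le_sum_Ico_inv`).  In momentum units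
  `(R+1)/(2‖k‖_∞) ≥ π/(2|p|_∞) ≥ π/(2|p|)`, i.e. this is the printed `O(1)|log p²| − O(1)`.
* `sum_bubbleSum_lower` (step 7): for `2 ≤ L`, `2L ≤ R`,
  `R⁴/(18L⁴)·log L ≤ Σ_{0 < ‖k‖_∞ ≤ ⌊R/(2L)⌋} Σ_{l ≠ 0, k; ‖l‖_∞ ≤ R} 1/(|k−l|²|l|²)` — the `(2ρ+1)⁴ − 1 ≥
  R⁴/(32L⁴)` momenta `k` of the sub-window `‖k‖_∞ ≤ ρ = ⌊R/(2L)⌋` (inside the printed window: `|p_μ| =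
  2π|k_μ|/T ≤ 2πR/(2LT) < π/L`) each contribute `≥ (16/9) log L` by step 6.
* `bubble_lower_GK` (the printed normalisation up to `(2π)⁻⁴`): `log L / 1458 ≤ L⁴/T⁴ · ΣΣ 1/(|k−l|²|l|²)`,
  `T = 2R+1`; and `bubble_lower_GK_momentum`: with `p = (2π/T)k`, `q = (2π/T)l`,
  `log L / (1458·(2π)⁴) ≤ L⁴ Λ⁻² Σ_p Σ_q 1/(|p−q|²|q|²)`, `Λ = T⁴` — i.e. "(…) ≥ O(1) log L" with an
  `O(1)` INDEPENDENT of `L`, of the volume `T⁴` (any `T ≥ 4L + 1`) and of the number of RG steps, which is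
  what p. 247 (3)/(5) assert and what the cell's target shape `b·log L − A` (`LLargeDominance`,
  `Beta.LargeL.LogGrowthLowerOn`) consumes.

**What is NOT reproduced.**  Steps 1–5 of (4) (Plancherel on the periodic box, positivity of the block
average, the window factor and the uniform bound `Ĝ_n(p) ≥ C₁/p²` — the elementary constants of steps 3–5
are in `LLargeDominance` §"(v1.3)"; the identification of `G_n`, `𝒢_n`, `Ĝ_n` with G–K's block-spin
covariances is model structure, not attempted); the exact printed intermediate `Σ_p |log p²|` (we pass
through `log((R+1)/(2‖k‖_∞))`, the same quantity up to an additive `O(1)`); torus distances (the printed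
`|p − q|` is read on representatives; replacing a representative by the shorter periodic one only increases a
summand, so the minorants stand either way).  Constants are not optimised.  Printed for G–K's scalar lattice
φ⁴₄ block-spin scheme ONLY; nothing here refers to or asserts anything about Bałaban's β-functions
(CMP 109 (1.22)) — whether Bałaban's one-loop coefficient contains such a bubble with `L`-uniform remainder
is the cell's OPEN item (TRANSFER.md §4 (d)).

**(v1.1, same seat) the printed ranges literally.**  §7 adds: `abs_momentum_lt_of_mem_window` — the sub-window
`0 < ‖k‖_∞ ≤ ⌊R/(2L)⌋` of `sum_bubbleSum_lower` lies inside the printed window, `|p_μ| = 2π|k_μ|/T < π/L` for every `μ`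
(`T = 2R+1`, `L ≥ 1`); `bubbleSum_lower_log_momentum` — step 6 in the printed form "≥ O(1)|log p²|":
`(8/9)·log(1/|p|²) ≤ Σ_{0<‖l‖_∞≤R, l≠k} 1/(|k−l|²|l|²)` for `p = (2π/T)k`, `k ≠ 0`, `R ≥ 2‖k‖_∞` (from `|p| ≥ (2π/T)‖k‖_∞` and
`T ≤ π(R+1)`); `sq_supNorm_le_normSq_toReal` (`‖k‖_∞² ≤ |k|²`); `bubbleSum_erase_eq` — the printed index set "0 ≠ p, q"
does not exclude `q = p` (cross-read GAPS C-adv2-34, R1): with `1/0 = 0` the `l = k` summand vanishes, so the sums with and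
without `erase k` agree.  All proved; nothing else changed.
-/

noncomputable section

open Real
open Literature.Probability.LatticeModels (annulus mem_annulus)
open Literature.MathematicalPhysics.QuantumFieldTheory.Balaban1983to89.Beta.DyadicShell (Pt supNorm toReal
  toReal_apply norm_toReal supNorm_pos supNorm_eq_of_mem_sphere mem_annulus_iff ne_zero_of_mem_annulus
  toReal_eq_zero_iff sum_Ico_shellSum supNorm_eq_zero_iff exists_eq_supNorm natAbs_le_supNorm)
open Literature.MathematicalPhysics.QuantumFieldTheory.Balaban1983to89.Beta.LeadingCoefficient (normSq
  normSq_nonneg normSq_le normSq_smul normSq_pos sq_le_normSq)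
open Literature.MathematicalPhysics.QuantumFieldTheory.Balaban1983to89.Beta.WindowLog (shellSum)
open Literature.MathematicalPhysics.QuantumFieldTheory.Balaban1983to89.Beta.TransferUV (card_annulus_succ_four
  card_annulus_zero)

namespace Literature.MathematicalPhysics.QuantumFieldTheory.GawedzkiKupiainen1985

/-! ## 1. Pointwise: on the sup-shell `‖l‖_∞ = s`, `s ≥ 2‖k‖_∞`, the bubble summand is `≥ 1/(36 s⁴)` -/

/-- `|l|² ≤ 4‖l‖_∞²` on `ℤ⁴` (four coordinates, each `≤ ‖l‖_∞` in absolute value). [folklore] -/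
theorem normSq_toReal_le (v : Pt) : normSq (toReal v) ≤ 4 * (supNorm v : ℝ) ^ 2 := by
  rw [← norm_toReal]; exact normSq_le _

/-- The embedding `ℤ⁴ → ℝ⁴` commutes with subtraction. [folklore] -/
theorem toReal_sub (k l : Pt) : toReal (k - l) = toReal k - toReal l := by
  ext i; simp [toReal_apply]

/-- If `2‖k‖_∞ ≤ ‖l‖_∞ = s` then `|k − l|² ≤ 4(‖k‖_∞ + s)² ≤ 9s²`. [folklore] -/
theorem normSq_toReal_sub_le {k l : Pt} (h : 2 * supNorm k ≤ supNorm l) :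
    normSq (toReal (k - l)) ≤ 9 * (supNorm l : ℝ) ^ 2 := by
  have h1 : normSq (toReal (k - l)) ≤ 4 * ‖toReal (k - l)‖ ^ 2 := normSq_le _
  have h2 : ‖toReal (k - l)‖ ≤ (supNorm k : ℝ) + supNorm l := by
    rw [toReal_sub, ← norm_toReal k, ← norm_toReal l]; exact norm_sub_le _ _
  have h3 : (2 : ℝ) * supNorm k ≤ supNorm l := by exact_mod_cast h
  have h5 : (2 * ‖toReal (k - l)‖) ^ 2 ≤ (3 * (supNorm l : ℝ)) ^ 2 :=
    pow_le_pow_left₀ (by positivity) (by linarith) 2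
  have e1 : (2 * ‖toReal (k - l)‖) ^ 2 = 4 * ‖toReal (k - l)‖ ^ 2 := by ring
  have e2 : (3 * (supNorm l : ℝ)) ^ 2 = 9 * (supNorm l : ℝ) ^ 2 := by ring
  linarith

/-- On such `l ≠ 0`: `1/(36 s⁴) ≤ 1/(|k − l|²|l|²)`, `s = ‖l‖_∞` (`|l|² ≤ 4s²`, `|k−l|² ≤ 9s²`; note `l ≠ k`
is forced, so both Euclidean lengths are positive). [folklore] -/
theorem bubbleTerm_lower {k l : Pt} (hl : l ≠ 0) (h : 2 * supNorm k ≤ supNorm l) :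
    1 / (36 * (supNorm l : ℝ) ^ 4) ≤ 1 / (normSq (toReal (k - l)) * normSq (toReal l)) := by
  have hkl : k - l ≠ 0 := by
    intro e
    have hkl' : k = l := sub_eq_zero.mp e
    subst hkl'
    have := supNorm_pos hl
    omega
  have hpos1 : 0 < normSq (toReal (k - l)) := normSq_pos fun e => hkl (toReal_eq_zero_iff.mp e)
  have hpos2 : 0 < normSq (toReal l) := normSq_pos fun e => hl (toReal_eq_zero_iff.mp e)
  apply one_div_le_one_div_of_le (mul_pos hpos1 hpos2)
  calc normSq (toReal (k - l)) * normSq (toReal l)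
      ≤ (9 * (supNorm l : ℝ) ^ 2) * (4 * (supNorm l : ℝ) ^ 2) :=
        mul_le_mul (normSq_toReal_sub_le h) (normSq_toReal_le l) hpos2.le (by positivity)
    _ = 36 * (supNorm l : ℝ) ^ 4 := by ring

/-! ## 2. One sup-shell of radius `s = r + 1 ≥ 2‖k‖_∞` contributes `≥ #shell/(36 s⁴) ≥ 64s³/(36s⁴) = 16/(9s)` -/

/-- Shellwise minorant: `16/(9(r+1)) ≤ Σ_{‖l‖_∞ = r+1} 1/(|k−l|²|l|²)` whenever `2‖k‖_∞ ≤ r + 1` (shell count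
`64(r+1)³ + 16(r+1)`, `Beta.TransferUV.card_annulus_succ_four`). [folklore] -/
theorem shellSum_bubbleTerm_lower {k : Pt} {r : ℕ} (h : 2 * supNorm k ≤ r + 1) :
    16 / (9 * ((r : ℝ) + 1)) ≤ shellSum (fun l => 1 / (normSq (toReal (k - l)) * normSq (toReal l))) r := by
  rw [shellSum]
  have ht : (0 : ℝ) < (r : ℝ) + 1 := by positivity
  have hshell : ∀ l ∈ annulus 4 r (r + 1),
      1 / (36 * ((r : ℝ) + 1) ^ 4) ≤ 1 / (normSq (toReal (k - l)) * normSq (toReal l)) := by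
    intro l hl
    have hs : supNorm l = r + 1 := supNorm_eq_of_mem_sphere hl
    have h0 : l ≠ 0 := ne_zero_of_mem_annulus hl
    have hb := bubbleTerm_lower (k := k) h0 (by rw [hs]; exact h)
    rw [hs] at hb
    push_cast at hb
    exact hb
  have hsum := Finset.card_nsmul_le_sum (annulus 4 r (r + 1))
    (fun l => 1 / (normSq (toReal (k - l)) * normSq (toReal l))) _ hshell
  rw [nsmul_eq_mul, card_annulus_succ_four] at hsum
  push_cast at hsum
  refine le_trans ?_ hsum
  rw [mul_one_div, div_le_div_iff₀ (by positivity) (by positivity)]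
  have e : (64 * ((r : ℝ) + 1) ^ 3 + 16 * ((r : ℝ) + 1)) * (9 * ((r : ℝ) + 1))
      = 16 * (36 * ((r : ℝ) + 1) ^ 4) + 144 * ((r : ℝ) + 1) ^ 2 := by ring
  rw [e]
  have : (0 : ℝ) ≤ 144 * ((r : ℝ) + 1) ^ 2 := by positivity
  linarith

/-! ## 3. Harmonic tails: `log((a+n)/a) ≤ Σ_{i<n} 1/(a+i)` -/

/-- `log((a + n)/a) ≤ Σ_{i<n} 1/(a+i)` for `a > 0` (from `log x ≤ x − 1`, telescoping). [folklore] -/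
theorem log_div_le_sum_range_inv {a : ℝ} (ha : 0 < a) (n : ℕ) :
    Real.log ((a + n) / a) ≤ ∑ i ∈ Finset.range n, 1 / (a + i) := by
  induction n with
  | zero => simp [ha.ne']
  | succ n ih =>
    rw [Finset.sum_range_succ]
    have han : 0 < a + n := by positivity
    have han1 : 0 < a + n + 1 := by positivity
    have e : (a + ((n + 1 : ℕ) : ℝ)) / a = ((a + n) / a) * ((a + n + 1) / (a + n)) := by
      push_cast
      field_simp
      ring
    rw [e, Real.log_mul (div_pos han ha).ne' (div_pos han1 han).ne']
    have h2 : Real.log ((a + n + 1) / (a + n)) ≤ 1 / (a + n) := by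
      have hx := Real.log_le_sub_one_of_pos (div_pos han1 han)
      have e2 : (a + n + 1) / (a + n) - 1 = 1 / (a + n) := by
        field_simp
        ring
      rw [e2] at hx
      exact hx
    linarith

/-- The same over an interval of shells: `log((R+1)/(m+1)) ≤ Σ_{m ≤ r < R} 1/(r+1)` (`m ≤ R`). [folklore] -/
theorem log_div_le_sum_Ico_inv {m R : ℕ} (h : m ≤ R) :
    Real.log (((R : ℝ) + 1) / ((m : ℝ) + 1)) ≤ ∑ r ∈ Finset.Ico m R, 1 / ((r : ℝ) + 1) := by
  rw [Finset.sum_Ico_eq_sum_range]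
  have hm : (0 : ℝ) < (m : ℝ) + 1 := by positivity
  have hlog := log_div_le_sum_range_inv hm (R - m)
  have e1 : (m : ℝ) + 1 + ((R - m : ℕ) : ℝ) = (R : ℝ) + 1 := by
    rw [Nat.cast_sub h]; ring
  rw [e1] at hlog
  refine hlog.trans (le_of_eq (Finset.sum_congr rfl fun i _ => ?_))
  push_cast
  ring

/-! ## 4. Step 6 of (4): the bubble at fixed external momentum `k ≠ 0` -/

/-- **G–K App. 1 (4), sixth step, integer form.**  For `k ∈ ℤ⁴ ∖ {0}` and `R ≥ 2‖k‖_∞`: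
`(16/9)·log((R+1)/(2‖k‖_∞)) ≤ Σ_{l ∈ ℤ⁴, 0 < ‖l‖_∞ ≤ R, l ≠ k} 1/(|k − l|²·|l|²)` (`|·|` Euclidean).  With
`p = 2πk/T`, `q = 2πl/T`, `T = 2R+1`, `Λ = T⁴` this is "(1/Λ_n) Σ_{q ≠ 0, p} |p−q|⁻²|q|⁻² ≥ O(1)|log p²|" up to
`(2π)⁻⁴` and an additive `O(1)`: `(R+1)/(2‖k‖_∞) ≥ π/(2|p|_∞)`.  Proof: keep only the sup-shells
`2‖k‖_∞ ≤ ‖l‖_∞ ≤ R` (`shellSum_bubbleTerm_lower`) and sum the harmonic tail (`log_div_le_sum_Ico_inv`).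
[cite: GawedzkiKupiainenMasslessLattice1985, App. 1 (4) p. 247, sixth step] -/
theorem bubbleSum_lower {k : Pt} (hk : k ≠ 0) {R : ℕ} (hR : 2 * supNorm k ≤ R) :
    16 / 9 * Real.log (((R : ℝ) + 1) / (2 * (supNorm k : ℝ))) ≤
      ∑ l ∈ (annulus 4 0 R).erase k, 1 / (normSq (toReal (k - l)) * normSq (toReal l)) := by
  have hK1 : 1 ≤ supNorm k := supNorm_pos hk
  have hsub : annulus 4 (2 * supNorm k - 1) R ⊆ (annulus 4 0 R).erase k := by
    intro l hl
    rw [mem_annulus_iff] at hl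
    rw [Finset.mem_erase, mem_annulus_iff]
    refine ⟨?_, by omega, hl.2⟩
    rintro rfl
    omega
  have hnonneg : ∀ l ∈ (annulus 4 0 R).erase k, l ∉ annulus 4 (2 * supNorm k - 1) R →
      0 ≤ 1 / (normSq (toReal (k - l)) * normSq (toReal l)) := fun l _ _ =>
    div_nonneg zero_le_one (mul_nonneg (normSq_nonneg _) (normSq_nonneg _))
  refine le_trans ?_ (Finset.sum_le_sum_of_subset_of_nonneg hsub hnonneg)
  rw [← sum_Ico_shellSum (fun l => 1 / (normSq (toReal (k - l)) * normSq (toReal l)))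
    (by omega : 2 * supNorm k - 1 ≤ R)]
  have hshell : ∀ r ∈ Finset.Ico (2 * supNorm k - 1) R, 16 / (9 * ((r : ℝ) + 1)) ≤
      shellSum (fun l => 1 / (normSq (toReal (k - l)) * normSq (toReal l))) r := by
    intro r hr
    rw [Finset.mem_Ico] at hr
    exact shellSum_bubbleTerm_lower (by omega)
  refine le_trans ?_ (Finset.sum_le_sum hshell)
  have hlog := log_div_le_sum_Ico_inv (by omega : 2 * supNorm k - 1 ≤ R)
  have e : ((2 * supNorm k - 1 : ℕ) : ℝ) + 1 = 2 * (supNorm k : ℝ) := by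
    have h1 : 2 * supNorm k - 1 + 1 = 2 * supNorm k := by omega
    exact_mod_cast h1
  rw [e] at hlog
  have e2 : ∑ r ∈ Finset.Ico (2 * supNorm k - 1) R, 16 / (9 * ((r : ℝ) + 1))
      = 16 / 9 * ∑ r ∈ Finset.Ico (2 * supNorm k - 1) R, 1 / ((r : ℝ) + 1) := by
    rw [Finset.mul_sum]
    refine Finset.sum_congr rfl fun r _ => ?_
    have : (0 : ℝ) < (r : ℝ) + 1 := by positivity
    field_simp
  rw [e2]
  exact mul_le_mul_of_nonneg_left hlog (by norm_num)

/-! ## 5. Step 7 of (4): summing `L⁴ ×` the bubble over the block-momentum window -/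

/-- **G–K App. 1 (4), seventh step, integer form.**  For `2 ≤ L` and `2L ≤ R`:
`R⁴/(18L⁴)·log L ≤ Σ_{0 < ‖k‖_∞ ≤ ⌊R/(2L)⌋} Σ_{0 < ‖l‖_∞ ≤ R, l ≠ k} 1/(|k−l|²|l|²)`: the sub-window
`‖k‖_∞ ≤ ρ := ⌊R/(2L)⌋` of the printed window `|p_μ| < π/L` (`p = 2πk/(2R+1)`) holds `(2ρ+1)⁴ − 1 ≥ R⁴/(32L⁴)`
momenta, each with bubble `≥ (16/9)·log((R+1)/(2ρ)) ≥ (16/9)·log L` by `bubbleSum_lower`.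
[cite: GawedzkiKupiainenMasslessLattice1985, App. 1 (4) p. 247, seventh step] -/
theorem sum_bubbleSum_lower {L R : ℕ} (hL : 2 ≤ L) (hR : 2 * L ≤ R) :
    (R : ℝ) ^ 4 / (18 * (L : ℝ) ^ 4) * Real.log L ≤
      ∑ k ∈ annulus 4 0 (R / (2 * L)), ∑ l ∈ (annulus 4 0 R).erase k,
        1 / (normSq (toReal (k - l)) * normSq (toReal l)) := by
  have h2L : 0 < 2 * L := by omega
  have hρ1 : 1 ≤ R / (2 * L) := (Nat.le_div_iff_mul_le h2L).mpr (by omega)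
  have hρL : R / (2 * L) * (2 * L) ≤ R := Nat.div_mul_le_self R (2 * L)
  have hRlt : R < 2 * L * (R / (2 * L) + 1) := Nat.lt_mul_div_succ R h2L
  have hL1 : (1 : ℝ) ≤ L := by exact_mod_cast (by omega : 1 ≤ L)
  have hlogL : 0 ≤ Real.log L := Real.log_nonneg hL1
  have hinner : ∀ k ∈ annulus 4 0 (R / (2 * L)), 16 / 9 * Real.log L ≤
      ∑ l ∈ (annulus 4 0 R).erase k, 1 / (normSq (toReal (k - l)) * normSq (toReal l)) := by
    intro k hk
    rw [mem_annulus_iff] at hk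
    have hk0 : k ≠ 0 := fun e => by
      rw [e] at hk
      have : supNorm (0 : Pt) = 0 := (supNorm_eq_zero_iff (w := (0 : Pt))).mpr rfl
      omega
    have hmul : L * (2 * supNorm k) ≤ R :=
      calc L * (2 * supNorm k) ≤ L * (2 * (R / (2 * L))) := Nat.mul_le_mul_left _ (by omega)
        _ = R / (2 * L) * (2 * L) := by ring
        _ ≤ R := hρL
    have hKR : 2 * supNorm k ≤ R := le_trans (Nat.le_mul_of_pos_left _ (by omega)) hmul
    refine le_trans ?_ (bubbleSum_lower hk0 hKR)
    refine mul_le_mul_of_nonneg_left ?_ (by norm_num)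
    have hKpos : (0 : ℝ) < 2 * (supNorm k : ℝ) := by
      have : (1 : ℝ) ≤ supNorm k := by exact_mod_cast supNorm_pos hk0
      linarith
    apply Real.log_le_log (by linarith)
    rw [le_div_iff₀ hKpos]
    have : (L : ℝ) * (2 * (supNorm k : ℝ)) ≤ R := by exact_mod_cast hmul
    linarith
  have hcount := Finset.card_nsmul_le_sum (annulus 4 0 (R / (2 * L))) _ _ hinner
  rw [nsmul_eq_mul, card_annulus_zero] at hcount
  have hcard : (R : ℝ) ^ 4 / (32 * (L : ℝ) ^ 4) ≤ (((2 * (R / (2 * L)) + 1) ^ 4 - 1 : ℕ) : ℝ) := by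
    have h1 : 1 ≤ (2 * (R / (2 * L)) + 1) ^ 4 := Nat.one_le_pow _ _ (by omega)
    rw [Nat.cast_sub h1]
    push_cast
    have hu : (R : ℝ) / (2 * L) ≤ 2 * ((R / (2 * L) : ℕ) : ℝ) + 1 := by
      rw [div_le_iff₀ (by positivity)]
      have h' : (R : ℝ) ≤ 2 * L * (((R / (2 * L) : ℕ) : ℝ) + 1) := by exact_mod_cast hRlt.le
      have h'' : (0 : ℝ) ≤ ((R / (2 * L) : ℕ) : ℝ) := Nat.cast_nonneg _
      have hL0 : (0 : ℝ) ≤ L := by positivity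
      nlinarith
    have hu4 : ((R : ℝ) / (2 * L)) ^ 4 ≤ (2 * ((R / (2 * L) : ℕ) : ℝ) + 1) ^ 4 :=
      pow_le_pow_left₀ (by positivity) hu 4
    have e : ((R : ℝ) / (2 * L)) ^ 4 = (R : ℝ) ^ 4 / (16 * (L : ℝ) ^ 4) := by
      rw [div_pow]; ring
    have h81 : (81 : ℝ) ≤ (2 * ((R / (2 * L) : ℕ) : ℝ) + 1) ^ 4 := by
      have h3 : (3 : ℝ) ≤ 2 * ((R / (2 * L) : ℕ) : ℝ) + 1 := by
        have : (1 : ℝ) ≤ ((R / (2 * L) : ℕ) : ℝ) := by exact_mod_cast hρ1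
        linarith
      calc (81 : ℝ) = 3 ^ 4 := by norm_num
        _ ≤ _ := pow_le_pow_left₀ (by norm_num) h3 4
    rw [e] at hu4
    have hL4 : (0 : ℝ) < (L : ℝ) ^ 4 := by positivity
    have e' : (R : ℝ) ^ 4 / (32 * (L : ℝ) ^ 4) = ((R : ℝ) ^ 4 / (16 * (L : ℝ) ^ 4)) / 2 := by
      field_simp
      ring
    rw [e']
    linarith
  calc (R : ℝ) ^ 4 / (18 * (L : ℝ) ^ 4) * Real.log L
      = ((R : ℝ) ^ 4 / (32 * (L : ℝ) ^ 4)) * (16 / 9 * Real.log L) := by ring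
    _ ≤ (((2 * (R / (2 * L)) + 1) ^ 4 - 1 : ℕ) : ℝ) * (16 / 9 * Real.log L) :=
        mul_le_mul_of_nonneg_right hcard (by positivity)
    _ ≤ _ := hcount

/-! ## 6. The printed normalisation: `L⁴ Λ⁻² Σ_p Σ_q |p − q|⁻²|q|⁻² ≥ O(1)·log L`, `O(1)` free of `L`, `Λ`, `n` -/

/-- **G–K App. 1 (4) ⇒ (5) in shape, integer coordinates**: for `2 ≤ L`, `2L ≤ R`, `T = 2R + 1`,
`log L / 1458 ≤ (L⁴/T⁴) · Σ_{0<‖k‖_∞≤⌊R/(2L)⌋} Σ_{0<‖l‖_∞≤R, l≠k} 1/(|k−l|²|l|²)` (`(R/T)⁴ ≥ 1/81` on top of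
`sum_bubbleSum_lower`).  The constant is independent of `L`, of the volume and of the scale index — the
content of "(1) ≥ O(1) log L (5)" with p. 247 (3) "O(1) L independent".
[cite: GawedzkiKupiainenMasslessLattice1985, App. 1 (4)–(5) p. 247] -/
theorem bubble_lower_GK {L R : ℕ} (hL : 2 ≤ L) (hR : 2 * L ≤ R) :
    Real.log L / 1458 ≤ (L : ℝ) ^ 4 / (2 * (R : ℝ) + 1) ^ 4 *
      ∑ k ∈ annulus 4 0 (R / (2 * L)), ∑ l ∈ (annulus 4 0 R).erase k,
        1 / (normSq (toReal (k - l)) * normSq (toReal l)) := by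
  have h := sum_bubbleSum_lower hL hR
  have hL0 : (0 : ℝ) < L := by exact_mod_cast (by omega : 0 < L)
  have hLne : (L : ℝ) ≠ 0 := hL0.ne'
  have hR1 : (1 : ℝ) ≤ R := by exact_mod_cast (by omega : 1 ≤ R)
  have hTne : (2 * (R : ℝ) + 1) ≠ 0 := by positivity
  have hlogL : 0 ≤ Real.log L := Real.log_nonneg (by exact_mod_cast (by omega : 1 ≤ L))
  have hq : (1 : ℝ) / 3 ≤ (R : ℝ) / (2 * R + 1) := by
    rw [div_le_div_iff₀ (by norm_num) (by positivity)]
    linarith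
  have hq4 : ((1 : ℝ) / 3) ^ 4 ≤ ((R : ℝ) / (2 * R + 1)) ^ 4 := pow_le_pow_left₀ (by norm_num) hq 4
  have hfac : 0 ≤ (L : ℝ) ^ 4 / (2 * (R : ℝ) + 1) ^ 4 := by positivity
  calc Real.log L / 1458 = ((1 : ℝ) / 3) ^ 4 * (Real.log L / 18) := by ring
    _ ≤ ((R : ℝ) / (2 * R + 1)) ^ 4 * (Real.log L / 18) :=
        mul_le_mul_of_nonneg_right hq4 (by positivity)
    _ = (L : ℝ) ^ 4 / (2 * (R : ℝ) + 1) ^ 4 * ((R : ℝ) ^ 4 / (18 * (L : ℝ) ^ 4) * Real.log L) := by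
        field_simp
    _ ≤ _ := mul_le_mul_of_nonneg_left h hfac

/-- **The same in momentum units** (`p = (2π/T)·k`, `q = (2π/T)·l`, `T = 2R+1`, `Λ = T⁴` sites):
`log L / (1458·(2π)⁴) ≤ L⁴ Λ⁻² Σ_p Σ_q 1/(|p − q|²|q|²)`, the sums running over the sub-window
`0 < ‖k‖_∞ ≤ ⌊R/(2L)⌋` of `{0 ≠ p, |p_μ| < π/L}` and over `{q ≠ 0, p; |l_μ| ≤ R}` — every omitted summand of the
printed double sum being `≥ 0`, this is a minorant of "L⁴ (1/Λ_n²) Σ_{0≠p,q; |p_μ|<π/L; −π<q_μ≤π} |p−q|⁻²|q|⁻²",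
hence (4)'s "≥ O(1) log L" with an explicit `L`-, `Λ`-, `n`-independent `O(1)`.
[cite: GawedzkiKupiainenMasslessLattice1985, App. 1 (4)–(5) p. 247] -/
theorem bubble_lower_GK_momentum {L R : ℕ} (hL : 2 ≤ L) (hR : 2 * L ≤ R) :
    Real.log L / (1458 * (2 * π) ^ 4) ≤ (L : ℝ) ^ 4 / ((2 * (R : ℝ) + 1) ^ 4) ^ 2 *
      ∑ k ∈ annulus 4 0 (R / (2 * L)), ∑ l ∈ (annulus 4 0 R).erase k,
        1 / (normSq ((2 * π / (2 * (R : ℝ) + 1)) • toReal k - (2 * π / (2 * (R : ℝ) + 1)) • toReal l) *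
          normSq ((2 * π / (2 * (R : ℝ) + 1)) • toReal l)) := by
  have h := bubble_lower_GK hL hR
  have hTpos : (0 : ℝ) < 2 * (R : ℝ) + 1 := by positivity
  have hterm : ∀ k l : Pt,
      1 / (normSq ((2 * π / (2 * (R : ℝ) + 1)) • toReal k - (2 * π / (2 * (R : ℝ) + 1)) • toReal l) *
          normSq ((2 * π / (2 * (R : ℝ) + 1)) • toReal l))
        = 1 / (2 * π / (2 * (R : ℝ) + 1)) ^ 4 * (1 / (normSq (toReal (k - l)) * normSq (toReal l))) := by
    intro k l
    rw [← smul_sub, ← toReal_sub, normSq_smul, normSq_smul, one_div_mul_one_div]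
    congr 1
    ring
  simp_rw [hterm, ← Finset.mul_sum]
  have hπ : (0 : ℝ) < 2 * π := by positivity
  have hc4 : 1 / (2 * π / (2 * (R : ℝ) + 1)) ^ 4 = (2 * (R : ℝ) + 1) ^ 4 / (2 * π) ^ 4 := by
    rw [div_pow, one_div_div]
  rw [hc4]
  have hS : 0 ≤ ∑ k ∈ annulus 4 0 (R / (2 * L)), ∑ l ∈ (annulus 4 0 R).erase k,
      1 / (normSq (toReal (k - l)) * normSq (toReal l)) :=
    Finset.sum_nonneg fun k _ => Finset.sum_nonneg fun l _ =>
      div_nonneg zero_le_one (mul_nonneg (normSq_nonneg _) (normSq_nonneg _))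
  calc Real.log L / (1458 * (2 * π) ^ 4) = (1 / (2 * π) ^ 4) * (Real.log L / 1458) := by
        field_simp
    _ ≤ (1 / (2 * π) ^ 4) * ((L : ℝ) ^ 4 / (2 * (R : ℝ) + 1) ^ 4 *
          ∑ k ∈ annulus 4 0 (R / (2 * L)), ∑ l ∈ (annulus 4 0 R).erase k,
            1 / (normSq (toReal (k - l)) * normSq (toReal l))) :=
        mul_le_mul_of_nonneg_left h (by positivity)
    _ = _ := by
        field_simp

/-! ## 7. (v1.1) The printed ranges literally: the sub-window lies inside `|p_μ| < π/L`, and the bubble minorant in the form `O(1)·|log p²|` -/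

/-- `sup² ≤ Σ squares`: `‖k‖_∞² ≤ |k|²` on `ℤ⁴`. [folklore] -/
theorem sq_supNorm_le_normSq_toReal (k : Pt) : (supNorm k : ℝ) ^ 2 ≤ normSq (toReal k) := by
  obtain ⟨i, hi⟩ := exists_eq_supNorm k
  have h1 : (toReal k i) ^ 2 ≤ normSq (toReal k) := sq_le_normSq _ i
  have h2 : (supNorm k : ℝ) ^ 2 = (toReal k i) ^ 2 := by
    rw [← hi, toReal_apply, Nat.cast_natAbs, Int.cast_abs, sq_abs]
  rw [h2]; exact h1

/-- The sub-window used in `sum_bubbleSum_lower` is inside the printed block-momentum window: if `0 < ‖k‖_∞ ≤ ⌊R/(2L)⌋`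
(`L ≥ 1`) then every component of `p = 2πk/T`, `T = 2R + 1`, satisfies `|p_μ| < π/L`. [folklore] -/
theorem abs_momentum_lt_of_mem_window {L R : ℕ} (hL : 1 ≤ L) {k : Pt} (hk : k ∈ annulus 4 0 (R / (2 * L)))
    (μ : Fin 4) : |2 * π * (k μ : ℝ) / (2 * (R : ℝ) + 1)| < π / L := by
  rw [mem_annulus_iff] at hk
  have hρL : R / (2 * L) * (2 * L) ≤ R := Nat.div_mul_le_self R (2 * L)
  have hkμ : (k μ).natAbs ≤ R / (2 * L) := (natAbs_le_supNorm k μ).trans hk.2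
  have h1 : |(k μ : ℝ)| ≤ ((R / (2 * L) : ℕ) : ℝ) := by
    rw [← Int.cast_abs, ← Nat.cast_natAbs]; exact_mod_cast hkμ
  have h2 : ((R / (2 * L) : ℕ) : ℝ) * (2 * L) ≤ R := by exact_mod_cast hρL
  have hT : (0 : ℝ) < 2 * (R : ℝ) + 1 := by positivity
  have hL0 : (0 : ℝ) < L := by exact_mod_cast hL
  rw [abs_div, abs_of_pos hT, abs_mul, abs_of_pos (by positivity : (0 : ℝ) < 2 * π),
    div_lt_div_iff₀ hT hL0]
  -- 2π|k_μ|·L ≤ π·(2L·⌊R/(2L)⌋) ≤ π·R < π·(2R+1)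
  have h3 : 2 * π * |(k μ : ℝ)| * L ≤ π * R :=
    calc 2 * π * |(k μ : ℝ)| * L = π * (|(k μ : ℝ)| * (2 * L)) := by ring
      _ ≤ π * (((R / (2 * L) : ℕ) : ℝ) * (2 * L)) := by gcongr
      _ ≤ π * R := by gcongr
  have hR0 : (0 : ℝ) ≤ R := Nat.cast_nonneg R
  nlinarith [Real.pi_pos, mul_nonneg Real.pi_pos.le hR0]

/-- **Step 6 of (4) in the printed form `≥ O(1)|log p²|`.**  For `k ≠ 0`, `R ≥ 2‖k‖_∞`, `p = (2π/T)k`, `T = 2R+1`: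
`(8/9)·log(1/|p|²) ≤ Σ_{0<‖l‖_∞≤R, l≠k} 1/(|k−l|²|l|²)` — since `|p| ≥ (2π/T)‖k‖_∞` gives `½·log(1/|p|²) ≤ log(T/(2π‖k‖_∞)) ≤
log((R+1)/(2‖k‖_∞))` (`T/(π(R+1)) < 1`), and `bubbleSum_lower`.  (For `|p|² ≤ 1`, `log(1/|p|²) = |log p²|`; the momentum-unit factor `(2π)⁻⁴Λ⁻¹`
of `bubble_lower_GK_momentum` is left off here.) [cite: GawedzkiKupiainenMasslessLattice1985, App. 1 (4) p. 247, sixth step] -/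
theorem bubbleSum_lower_log_momentum {k : Pt} (hk : k ≠ 0) {R : ℕ} (hR : 2 * supNorm k ≤ R) :
    8 / 9 * Real.log (1 / normSq ((2 * π / (2 * (R : ℝ) + 1)) • toReal k)) ≤
      ∑ l ∈ (annulus 4 0 R).erase k, 1 / (normSq (toReal (k - l)) * normSq (toReal l)) := by
  refine le_trans ?_ (bubbleSum_lower hk hR)
  have hK : (1 : ℝ) ≤ supNorm k := by exact_mod_cast supNorm_pos hk
  have hT : (0 : ℝ) < 2 * (R : ℝ) + 1 := by positivity
  set c : ℝ := 2 * π / (2 * (R : ℝ) + 1) with hc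
  have hc0 : 0 < c := by positivity
  have hP : c ^ 2 * (supNorm k : ℝ) ^ 2 ≤ normSq (c • toReal k) := by
    rw [normSq_smul]
    exact mul_le_mul_of_nonneg_left (sq_supNorm_le_normSq_toReal k) (sq_nonneg _)
  have hPpos : 0 < normSq (c • toReal k) := lt_of_lt_of_le (by positivity) hP
  -- log(1/|p|²) ≤ log(1/(c²K²)) = 2·log(1/(cK)) and 1/(cK) = T/(2πK) ≤ (R+1)/(2K)
  have h1 : Real.log (1 / normSq (c • toReal k)) ≤ Real.log (1 / (c ^ 2 * (supNorm k : ℝ) ^ 2)) :=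
    Real.log_le_log (by positivity) (one_div_le_one_div_of_le (by positivity) hP)
  have h2 : Real.log (1 / (c ^ 2 * (supNorm k : ℝ) ^ 2)) = 2 * Real.log (1 / (c * supNorm k)) := by
    rw [← Real.log_rpow (by positivity), Real.rpow_two]
    congr 1
    field_simp
  have h3 : 1 / (c * supNorm k) ≤ ((R : ℝ) + 1) / (2 * (supNorm k : ℝ)) := by
    rw [hc, div_le_div_iff₀ (by positivity) (by positivity)]
    -- (2K) ≤ (R+1)·(2π/T)·K  ⟸  T ≤ π(R+1)
    have hπ : (3 : ℝ) < π := Real.pi_gt_three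
    have : (2 * (R : ℝ) + 1) ≤ π * ((R : ℝ) + 1) := by nlinarith
    have hK0 : (0 : ℝ) ≤ supNorm k := by positivity
    calc 1 * (2 * (supNorm k : ℝ)) = (2 * (R : ℝ) + 1) * (2 / (2 * (R : ℝ) + 1)) * supNorm k := by
          field_simp
      _ ≤ π * ((R : ℝ) + 1) * (2 / (2 * (R : ℝ) + 1)) * supNorm k := by gcongr
      _ = ((R : ℝ) + 1) * (2 * π / (2 * (R : ℝ) + 1) * supNorm k) := by ring
  have h4 : Real.log (1 / (c * supNorm k)) ≤ Real.log (((R : ℝ) + 1) / (2 * (supNorm k : ℝ))) :=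
    Real.log_le_log (by positivity) h3
  calc 8 / 9 * Real.log (1 / normSq (c • toReal k))
      ≤ 8 / 9 * (2 * Real.log (1 / (c * supNorm k))) := by
        refine mul_le_mul_of_nonneg_left (h1.trans (le_of_eq h2)) (by norm_num)
    _ = 16 / 9 * Real.log (1 / (c * supNorm k)) := by ring
    _ ≤ 16 / 9 * Real.log (((R : ℝ) + 1) / (2 * (supNorm k : ℝ))) := mul_le_mul_of_nonneg_left h4 (by norm_num)

/-- (XREAD C-adv2-34, remark R1.)  The printed index set "0 ≠ p, q" of the sixth member of (4) does not exclude `q = p`;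
the sums above erase `l = k`.  Under Lean's convention `1/0 = 0` the summand at `l = k` is `1/(|0|²·|k|²) = 0`, so the erased and
the un-erased sums coincide and every minorant above holds verbatim over `{0 < ‖l‖_∞ ≤ R}`. [folklore] -/
theorem bubbleSum_erase_eq (k : Pt) (R : ℕ) :
    ∑ l ∈ (annulus 4 0 R).erase k, 1 / (normSq (toReal (k - l)) * normSq (toReal l)) =
      ∑ l ∈ annulus 4 0 R, 1 / (normSq (toReal (k - l)) * normSq (toReal l)) := by
  apply Finset.sum_erase
  rw [sub_self, toReal_eq_zero_iff.mpr rfl]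
  simp [normSq]

end Literature.MathematicalPhysics.QuantumFieldTheory.GawedzkiKupiainen1985

end
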